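import Summits.QuantumFields.BalabanUV.Beta.FP.TowerFWeightColumnStraight
import Summits.QuantumFields.BalabanUV.Beta.NVertexColumnK1Row
import Summits.QuantumFields.BalabanUV.Beta.GAN24.AxProjBmWindow
import Summits.QuantumFields.BalabanUV.Beta.GAN24.RespStepBmDecompExact
import Summits.QuantumFields.BalabanUV.Beta.GAN24.CoDressedFieldRowSums
import Summits.QuantumFields.BalabanUV.Beta.FP.CompositeMinimiserDecay

/-!
# `BalabanUV.Beta.FP.TowerFWeightDressingInvisible` — row D1 ∕ (C1) OWNER «beta-an2», PART 101b, ROUTE T (β1), option (3a): **THE DRESSING-INVISIBILITY LETTER (DIᶜ)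
# PROVED ON `ℤ⁴`, AT EVERY STOREY, EVERY ROOT FAMILY, EVERY CONTOUR SCALE** (journal [AN2-G85-W-14] `K1C-SCOPING.md` steps (2)–(6), [AN2-G85-S-9]):
# for bounded co-closed middle covectors `ψ` (`|ψ| ≤ M`, `codiff₁ ψ = 0`) and any `Mc ≥ 1`,
# **`⟨ψ, contourSum Mc (colH (AN R (n+1)) (Lc^(n+2)) a 0)⟩ = ⟨ψ, contourSum Mc (colH (KInv (N := Lc^(n+2))) (Lc^(n+2)) a 0)⟩`** (`dressingInvisible`).
# WHY IT HOLDS BY NAME: an2 g63 PART 22 `colH_AN_eq_corrPsi_coProjBmW_Hcol` (the composite chart's column is `Ψ̂_{n+2} (Π_bm ℋ_L(·; a, 0))`), L1 `corrPsi … A = A + c • dz (ext …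
# (compDefectAt …))`, GAN24 `axProjBmAt_eq_coProjBmW'` + `axProjBmAt ρ N A = A − grad (bmGaugeAt ρ A N)` — so the column is the STRAIGHT column plus two FINE GRADIENTS; lit
# `contourSum_dz` turns their contour sums into MIDDLE gradients `dz (blockSum Mc ·)`; an2 g60 `lip1_dz_eq_zero_of_bounded` kills them against bounded co-closed `ψ` — given
# SUMMABILITY of the two potentials, which §1 supplies: `summable_blockSum`, `summable_contourSum'`, `summable_treeGaugeAt` (GAN24 `abs_treeGaugeAt_le_blockMass`),
# `summable_linAvgAt` (an2 `contourSum_sub_linAvgAt`: re-rooting is a coarse exact form), `summable_compLinAvgAt`, **`summable_compDefectAt`** (the composite defect potential of a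
# summable form is summable — K1C-SCOPING's one missing letter (6b)), GAN24 `summable_bmGaugeAt`, `summable_coProjBmW`, `summable_comp_blk'`.
# CONSEQUENCE (§3, with PART 101a `columnLetter_of_dressingInvisible` ∕ `hgaugeD_rooted∕sym_of_dressingInvisible`, p759950 ✓): **(K1ᶜ)_n HOLDS BY NAME —
# `⟨ψ, contourSum (Lc^(n+1)) (colH (chartσ Lc (sn n) n) (Lc^(n+2)) a 0)⟩ = (sn n)⁻¹ · ⟨ψ, wStep Lc (n+1) · a (−·)⟩` (`lip1_contourSum_colH_chartσ_eq`), i.e. PART 100's `hK1c` at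
# `α n = (sn n · (Lc⁴)^(n+1))⁻¹` (`columnLetter`), and the road's dual gauge letter `hgaugeD n` at both row tokens follows from `sn n ≠ 0` ALONE (`hgaugeD_rooted`, `hgaugeD_sym`)** —
# the (3a) END's F-side then displays only `hW𝒯 j` (j ≥ 1) and the scalars.  At (4,3), n = 0, sn 0 = 3⁵: α 0 = 3⁻⁹ for `wFRec` as typed (PREDICTION-AN2-85d, now by name).
# (β-function cell `pub-balaban`, BINDER-OWNERS row D1)

WHAT ([folklore]; 0 `def`): §1 summability letters (above) + `summable_comp_zsmul_add`, `summable_pair_of_bounded`, `lip1_add_dz_eq`; §2 `summable_Hcol_zero`, `summable_colH_KInv_zero`,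
**`contourSum_colH_AN_eq_add_dz`** (`∃ G, Summable G ∧ contourSum Mc colN = contourSum Mc (straight column) + dz G`), **`dressingInvisible`**, **`dressingInvisible_ctr`** (PART 101a's
`hinv` TEXT at the record's roots `Roots.ctr Lc` and scale `Lc^(n+1)`); §3 **`lip1_contourSum_colH_chartσ_eq`**, **`columnLetter`** ((K1ᶜ)_n, PART 100's `hK1c` text),
**`hgaugeD_rooted`**, **`hgaugeD_sym`** (the road's `hgaugeD n` TEXT from `sn n ≠ 0` and the value of `α n`).
WHAT THIS IS NOT: nothing of the END instantiated (the road feeds `hgaugeD` from here); `hW𝒯 j` (j ≥ 1) untouched; nothing of Bałaban's asserted, valued or discharged; 0 estimates; 0∕4 row-D1 binders;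
NOT (C1), NOT D1, NEVER «G-an2-4 closed», NOT BetaPertH, NOT continuum, NOT Clay.

HONEST DEPENDENCY (page 1, mandatory): continuum YM on T⁴ ⇐ BetaPertH ∧ nine spine estimates (0/9 proved); BetaPertH ⇐ (D1) ∧ (D4) ∧ CAP+tail;
G-an2-4 gates asym, D1 and NE2/3/4.  HONEST FRAMING (cell contract, verbatim): «discharging `BetaPertH` makes Bałaban's UV stability UNCONDITIONAL —
a real constructive-QFT result; it is NOT the continuum limit and NOT the Clay problem.»  ABSOLUTE RULE (cell charter, verbatim): «No internally-minted
statement may enter as a cited fact. Every hypothesis is either kernel-proved in this package or a verbatim quotation of a PUBLISHED theorem with page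
reference. The manuscript(s) under audit are NOT citable for their own disputed steps — they are the thing under adjudication; programme-internal
(2001/route/tribunal) claims are never citable.»  Row D1 ∕ (C1) OWNER «beta-an2», b2b-balaban-beta-an2 gen 85, 2026-08-30.  No existing file touched.
-/

noncomputable section

open Finset
open scoped BigOperators
open Literature.MathematicalPhysics.QuantumFieldTheory
open Literature.MathematicalPhysics.QuantumFieldTheory.Balaban1983to89
open Literature.MathematicalPhysics.QuantumFieldTheory.Balaban1983to89.Beta
open AffineAveraging (Form0 Form1 Site box toSite unitVec dz codiff₁ contourSum blockSum contourSum_dz)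
open AveragingContours (blk grad)
open AveragingContoursRooted (ctrOff ctrOff_mem_box linAvgAt treeGaugeAt)
open AxialDressing (blockMass blockMass_nonneg summable_blockMass summable_comp_blk)
open OneStepResolventKernel (Fib KInv)
open OneStepKernelFamily (colH)
open KKTFluctuationEnergy (lip1 summable_dz)
open HessianTelescopingKKT (wStep KInv_inl_inr_zero)
open AveragingHessianKernelsRooted (linKerAt)
open ResolventComposition (Hcol Hcol_apply)
open Summit.QuantumFields.BalabanUV.Beta.AxialDressingRooted (one_le_of_neZero coProjBmW)
open Summit.QuantumFields.BalabanUV.Beta.AxialProjectorBlockMean (bmGaugeAt axProjBmAt)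
open Summit.QuantumFields.BalabanUV.Beta.CompositeAveragingCoarseExact (compLinAvgAt compDefectAt compLinAvgAt_succ compDefectAt_zero compDefectAt_succ)
open Summit.QuantumFields.BalabanUV.Beta.CompositeCorrectorForms (ext corrPsi)
open Summit.QuantumFields.BalabanUV.Beta.AveragingPointsOfView (contourSum_sub_linAvgAt)
open Summit.QuantumFields.BalabanUV.Beta.CompositeOneShotJetData (Roots Roots.ctr AN)
open Summit.QuantumFields.BalabanUV.Beta.CoclosedCovectorLinearRows (lip1_dz_eq_zero_of_bounded)
open Summit.QuantumFields.BalabanUV.Beta.BlockMeanChartK1Row (colH_KInv_eq_Hcol)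
open Summit.QuantumFields.BalabanUV.Beta.NVertexColumnK1Row (colH_AN_eq_corrPsi_coProjBmW_Hcol)
open Summit.QuantumFields.BalabanUV.Beta.GAN24.AxProjBmWindow (axProjBmAt_eq_coProjBmW)
open Summit.QuantumFields.BalabanUV.Beta.GAN24.RespStepBmDecompExact (abs_treeGaugeAt_le_blockMass summable_bmGaugeAt summable_comp_blk')
open Summit.QuantumFields.BalabanUV.Beta.GAN24.CoDressedFieldRowSums (summable_coProjBmW)
open Summit.QuantumFields.BalabanUV.Beta.FP.CompositeMinimiserDecay (summable_wH)
open Summit.QuantumFields.BalabanUV.Beta.SymAveragingHessianCounts (symLinKerAt)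
open Summit.QuantumFields.BalabanUV.Beta.FP.TorusCompositeObjectsG (StepRows)
open Summit.QuantumFields.BalabanUV.Beta.FP.TowerFWeightRecDefs (chartσ wF)
open Summit.QuantumFields.BalabanUV.Beta.FP.TowerFWeightColumnStraight (columnLetter_of_dressingInvisible
  hgaugeD_rooted_of_dressingInvisible hgaugeD_sym_of_dressingInvisible)

namespace Summit.QuantumFields.BalabanUV.Beta.FP.TowerFWeightDressingInvisible

/-! ## §1 Summability letters: block sums, contour sums, rooted tree gauges, rooted linear averages, the composite and its defect potential -/

section Summable

variable {d : ℕ}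

/-- [folklore] a summable function read along an affine sublattice `y ↦ M•y + v` (`M ≥ 1`, injective) is summable. -/
theorem summable_comp_zsmul_add {M : ℕ} (hM : 1 ≤ M) {f : Form0 (d + 1) ℝ} (hf : Summable f) (v : Site (d + 1)) :
    Summable fun y : Site (d + 1) => f (((M : ℕ) : ℤ) • y + v) := by
  have hi : Function.Injective fun y : Site (d + 1) => (M : ℤ) • y + v := by
    intro y₁ y₂ h
    have h' : (M : ℤ) • y₁ = (M : ℤ) • y₂ := add_right_cancel h
    funext i
    have hi := congr_fun h' i
    simp only [Pi.smul_apply, smul_eq_mul] at hi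
    exact mul_left_cancel₀ (by exact_mod_cast (by omega : M ≠ 0)) hi
  exact hf.comp_injective hi

/-- [folklore] **block sums of summable functions are summable** (a finite sum of affine readings). -/
theorem summable_blockSum {M : ℕ} (hM : 1 ≤ M) {f : Form0 (d + 1) ℝ} (hf : Summable f) : Summable (blockSum M f) := by
  unfold AffineAveraging.blockSum
  exact summable_sum fun b _ => summable_comp_zsmul_add hM hf (toSite b)

/-- [folklore] **straight contour sums of componentwise-summable 1-forms are summable.** -/
theorem summable_contourSum' {M : ℕ} (hM : 1 ≤ M) {A : Form1 (d + 1) ℝ} (hA : ∀ κ, Summable (A κ)) (κ : Fin (d + 1)) :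
    Summable (contourSum M A κ) := by
  show Summable fun y => ∑ b ∈ box (d + 1) M, ∑ s ∈ Finset.range M, A κ (((M : ℕ) : ℤ) • y + toSite b + (s : ℤ) • unitVec κ)
  refine summable_sum fun b _ => summable_sum fun s _ => ?_
  have h := summable_comp_zsmul_add hM (hA κ) (toSite b + (s : ℤ) • unitVec κ)
  exact h.congr fun y => by rw [add_assoc]

/-- [folklore] **the rooted tree gauge of a componentwise-summable 1-form is summable** (in-block root; majorant `(d+1)N · blockMass ∘ blk`, GAN24 `abs_treeGaugeAt_le_blockMass`). -/
theorem summable_treeGaugeAt {N : ℕ} (hN : 1 ≤ N) {rr : Fin (d + 1) → ℕ} (hrr : rr ∈ box (d + 1) N) {A : Form1 (d + 1) ℝ}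
    (hA : ∀ κ, Summable (A κ)) : Summable (treeGaugeAt (toSite rr) A N) := by
  haveI : NeZero N := ⟨by omega⟩
  have hmaj : Summable (fun p : Site (d + 1) => (((d : ℝ) + 1) * N) * blockMass N A (blk N p)) :=
    (summable_comp_blk hN (summable_blockMass hA) (blockMass_nonneg N A)).mul_left _
  exact Summable.of_norm_bounded hmaj fun p => by rw [Real.norm_eq_abs]; exact abs_treeGaugeAt_le_blockMass hN hrr A p

/-- [folklore] **the rooted linear average of a componentwise-summable 1-form is summable** — it is the straight contour sum minus the coarse gradient of the block sum of the
tree gauge (an2 `contourSum_sub_linAvgAt`: «re-rooting is a coarse exact form»). -/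
theorem summable_linAvgAt {N : ℕ} (hN : 1 ≤ N) {rr : Fin (d + 1) → ℕ} (hrr : rr ∈ box (d + 1) N) {A : Form1 (d + 1) ℝ}
    (hA : ∀ κ, Summable (A κ)) (μ : Fin (d + 1)) : Summable (linAvgAt (toSite rr) A N μ) := by
  have h : (linAvgAt (toSite rr) A N μ : Site (d + 1) → ℝ)
      = fun y => contourSum N A μ y - dz (blockSum N (treeGaugeAt (toSite rr) A N)) μ y := by
    funext y
    rw [← contourSum_sub_linAvgAt rr A μ y]
    ring
  rw [h]
  exact (summable_contourSum' hN hA μ).sub (summable_dz (summable_blockSum hN (summable_treeGaugeAt hN hrr hA)) μ)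

/-- [folklore] **every level of the composite rooted average of a componentwise-summable 1-form is componentwise summable.** -/
theorem summable_compLinAvgAt {L : ℕ} (hL : 1 ≤ L) (r : ℕ → Fin (d + 1) → ℕ) (hr : ∀ k, r k ∈ box (d + 1) L) {A : Form1 (d + 1) ℝ}
    (hA : ∀ κ, Summable (A κ)) : ∀ (m : ℕ) (κ : Fin (d + 1)), Summable (compLinAvgAt r L m A κ)
  | 0, κ => hA κ
  | m + 1, κ => by
      rw [compLinAvgAt_succ]
      exact summable_linAvgAt hL (hr m) (summable_compLinAvgAt hL r hr hA m) κ

/-- [folklore] **THE COMPOSITE DEFECT POTENTIAL OF A COMPONENTWISE-SUMMABLE 1-FORM IS SUMMABLE** (K1C-SCOPING's letter (6b)): `ζ_{m+1} = blockSum L (ζ_m + treeGaugeAt ρ_m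
(compLinAvgAt r L m A) L)` by induction. -/
theorem summable_compDefectAt {L : ℕ} (hL : 1 ≤ L) (r : ℕ → Fin (d + 1) → ℕ) (hr : ∀ k, r k ∈ box (d + 1) L) {A : Form1 (d + 1) ℝ}
    (hA : ∀ κ, Summable (A κ)) : ∀ m : ℕ, Summable (compDefectAt r L m A)
  | 0 => by rw [compDefectAt_zero]; exact summable_zero
  | m + 1 => by
      rw [compDefectAt_succ]
      exact summable_blockSum hL
        ((summable_compDefectAt hL r hr hA m).add (summable_treeGaugeAt hL (hr m) (summable_compLinAvgAt hL r hr hA m)))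

/-- [folklore] the pairing of a bounded covector with a componentwise-summable 1-form converges (row sums). -/
theorem summable_pair_of_bounded {ψ : Form1 (d + 1) ℝ} {M : ℝ} (hψ : ∀ c x, |ψ c x| ≤ M) {X : Form1 (d + 1) ℝ} (hX : ∀ κ, Summable (X κ)) :
    Summable fun t : Site (d + 1) => ∑ κ, ψ κ t * X κ t := by
  refine summable_sum fun κ _ => ?_
  refine Summable.of_norm_bounded (((hX κ).abs).mul_left M) fun t => ?_
  rw [Real.norm_eq_abs, abs_mul]
  exact mul_le_mul_of_nonneg_right (hψ κ t) (abs_nonneg _)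

/-- [folklore] **a bounded co-closed covector does not see a summable gradient added to a summable 1-form**: `⟨ψ, X + dz G⟩ = ⟨ψ, X⟩` (an2 g60 `lip1_dz_eq_zero_of_bounded`). -/
theorem lip1_add_dz_eq {ψ : Form1 (d + 1) ℝ} {M : ℝ} (hψ : ∀ c x, |ψ c x| ≤ M) (hco : codiff₁ ψ = 0) {X : Form1 (d + 1) ℝ}
    (hX : ∀ κ, Summable (X κ)) {G : Form0 (d + 1) ℝ} (hG : Summable G) :
    lip1 ψ (fun κ t => X κ t + dz G κ t) = lip1 ψ X := by
  have h0 : lip1 ψ (dz G) = 0 := lip1_dz_eq_zero_of_bounded hψ hco hG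
  unfold lip1 at h0 ⊢
  have hXs : Summable fun t => ∑ κ, ψ κ t * X κ t := summable_pair_of_bounded hψ hX
  have hDs : Summable fun t => ∑ κ, ψ κ t * dz G κ t := summable_pair_of_bounded hψ fun κ => summable_dz hG κ
  have hsplit : ∀ t, ∑ κ, ψ κ t * (X κ t + dz G κ t) = (∑ κ, ψ κ t * X κ t) + ∑ κ, ψ κ t * dz G κ t := fun t => by
    rw [← Finset.sum_add_distrib]
    exact Finset.sum_congr rfl fun κ _ => by ring
  simp_rw [hsplit]
  rw [hXs.tsum_add hDs, h0, add_zero]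

end Summable

/-! ## §2 The composite column = the straight column + two fine gradients; (DIᶜ) -/

section Column

variable (Lc : ℕ) [NeZero Lc]

/-- [folklore] the straight minimiser column at the coarse origin is componentwise summable (an2 `summable_wH`). -/
theorem summable_Hcol_zero (L : ℕ) [NeZero L] (a κ : Fin (3 + 1)) : Summable (Hcol (N := L) a 0 κ) := by
  have h : (Hcol (N := L) a 0 κ : Site (3 + 1) → ℝ) = fun z => KernelSpecInstance.wH (N := L) κ a z := by
    funext z; rw [Hcol_apply, smul_zero, sub_zero]
  rw [h]
  exact summable_wH _ κ a

/-- [folklore] the same column in `colH (KInv) L a 0` spelling. -/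
theorem summable_colH_KInv_zero (L : ℕ) [NeZero L] (a κ : Fin (3 + 1)) : Summable fun u : Site (3 + 1) => colH (KInv (N := L)) L a 0 κ u := by
  have h : (fun u : Site (3 + 1) => colH (KInv (N := L)) L a 0 κ u) = fun z => KernelSpecInstance.wH (N := L) κ a z := by
    funext z; simp only [colH, smul_zero, KInv_inl_inr_zero]
  rw [h]
  exact summable_wH _ κ a

/-- [folklore] **THE COMPOSITE CHART's COLUMN, CONTOUR-SUMMED AT ANY SCALE, IS THE STRAIGHT COLUMN's CONTOUR SUM PLUS A SUMMABLE MIDDLE GRADIENT**: with `L = Lc^(n+2)`,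
`ρ = toSite (R.s (n+2))`, `ℋ = Hcol (N := L) a 0`, `B = Π_bm ℋ = coProjBmW ρ L ℋ = ℋ − dz (bmGaugeAt ρ ℋ L)`, `ζ = compDefectAt R.rc Lc (n+2) B`, `c = |box (Lc^(n+2))|⁻¹`:
`contourSum Mc (colH (AN R (n+1)) L a 0) = contourSum Mc (colH KInv L a 0) + dz G`, `G = c · blockSum Mc (ext L ζ) − blockSum Mc (bmGaugeAt ρ ℋ L)` — summable by §1. -/
theorem contourSum_colH_AN_eq_add_dz (R : Roots Lc) (n : ℕ) {Mc : ℕ} (hMc : 1 ≤ Mc) (a : Fin (3 + 1)) :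
    ∃ G : Form0 (3 + 1) ℝ, Summable G ∧ ∀ (κ : Fin (3 + 1)) (t : Site (3 + 1)),
      contourSum Mc (fun κ' u => colH (AN R (n + 1)) (Lc ^ (n + 1 + 1)) a 0 κ' u) κ t
        = contourSum Mc (fun κ' u => colH (KInv (N := Lc ^ (n + 1 + 1))) (Lc ^ (n + 1 + 1)) a 0 κ' u) κ t + dz G κ t := by
  have hLc1 : 1 ≤ Lc := one_le_of_neZero Lc
  have hL1 : 1 ≤ Lc ^ (n + 1 + 1) := one_le_of_neZero (Lc ^ (n + 1 + 1))
  have hHs : ∀ κ, Summable (Hcol (N := Lc ^ (n + 1 + 1)) a 0 κ) := fun κ => summable_Hcol_zero (Lc ^ (n + 1 + 1)) a κ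
  have hBs : ∀ κ, Summable (coProjBmW (toSite (R.s (n + 1 + 1))) (Lc ^ (n + 1 + 1)) (Hcol (N := Lc ^ (n + 1 + 1)) a 0) κ) :=
    fun κ => summable_coProjBmW hL1 (R.hs (n + 1 + 1)) hHs κ
  have hgs : Summable (bmGaugeAt (toSite (R.s (n + 1 + 1))) (Hcol (N := Lc ^ (n + 1 + 1)) a 0) (Lc ^ (n + 1 + 1))) :=
    summable_bmGaugeAt hL1 (R.hs (n + 1 + 1)) hHs
  have hζs : Summable (compDefectAt R.rc Lc (n + 1 + 1)
      (coProjBmW (toSite (R.s (n + 1 + 1))) (Lc ^ (n + 1 + 1)) (Hcol (N := Lc ^ (n + 1 + 1)) a 0))) :=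
    summable_compDefectAt hLc1 R.rc R.hrc hBs (n + 1 + 1)
  refine ⟨fun x => (((box (3 + 1) (Lc ^ (n + 1 + 1))).card : ℝ))⁻¹
      * blockSum Mc (ext (Lc ^ (n + 1 + 1)) (compDefectAt R.rc Lc (n + 1 + 1)
          (coProjBmW (toSite (R.s (n + 1 + 1))) (Lc ^ (n + 1 + 1)) (Hcol (N := Lc ^ (n + 1 + 1)) a 0)))) x
      - blockSum Mc (bmGaugeAt (toSite (R.s (n + 1 + 1))) (Hcol (N := Lc ^ (n + 1 + 1)) a 0) (Lc ^ (n + 1 + 1))) x, ?_, ?_⟩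
  · exact ((summable_blockSum hMc (summable_comp_blk' hL1 hζs)).mul_left _).sub (summable_blockSum hMc hgs)
  · intro κ t
    -- the column, pointwise: straight column − fine gauge gradient + the corrector's fine gradient
    have hcol : ∀ (κ' : Fin (3 + 1)) (u : Site (3 + 1)), colH (AN R (n + 1)) (Lc ^ (n + 1 + 1)) a 0 κ' u
        = Hcol (N := Lc ^ (n + 1 + 1)) a 0 κ' u
          - dz (bmGaugeAt (toSite (R.s (n + 1 + 1))) (Hcol (N := Lc ^ (n + 1 + 1)) a 0) (Lc ^ (n + 1 + 1))) κ' u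
          + (((box (3 + 1) (Lc ^ (n + 1 + 1))).card : ℝ))⁻¹
            * dz (ext (Lc ^ (n + 1 + 1)) (compDefectAt R.rc Lc (n + 1 + 1)
                (coProjBmW (toSite (R.s (n + 1 + 1))) (Lc ^ (n + 1 + 1)) (Hcol (N := Lc ^ (n + 1 + 1)) a 0)))) κ' u := by
      intro κ' u
      have h1 := congrFun (congrFun (colH_AN_eq_corrPsi_coProjBmW_Hcol R (n + 1) a 0) κ') u
      have h2 : coProjBmW (toSite (R.s (n + 1 + 1))) (Lc ^ (n + 1 + 1)) (Hcol (N := Lc ^ (n + 1 + 1)) a 0) κ' u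
          = Hcol (N := Lc ^ (n + 1 + 1)) a 0 κ' u
            - dz (bmGaugeAt (toSite (R.s (n + 1 + 1))) (Hcol (N := Lc ^ (n + 1 + 1)) a 0) (Lc ^ (n + 1 + 1))) κ' u := by
        rw [← axProjBmAt_eq_coProjBmW hL1 (R.hs (n + 1 + 1))]
        rfl
      rw [h1]
      simp only [corrPsi, Pi.add_apply, Pi.smul_apply, smul_eq_mul, h2]
    have hK : ∀ (κ' : Fin (3 + 1)) (u : Site (3 + 1)), colH (KInv (N := Lc ^ (n + 1 + 1))) (Lc ^ (n + 1 + 1)) a 0 κ' u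
        = Hcol (N := Lc ^ (n + 1 + 1)) a 0 κ' u := fun κ' u => congrFun (congrFun (colH_KInv_eq_Hcol (N := Lc ^ (n + 1 + 1)) a 0) κ') u
    have hg := congrFun (congrFun (contourSum_dz Mc (bmGaugeAt (toSite (R.s (n + 1 + 1))) (Hcol (N := Lc ^ (n + 1 + 1)) a 0) (Lc ^ (n + 1 + 1)))) κ) t
    have hζ := congrFun (congrFun (contourSum_dz Mc (ext (Lc ^ (n + 1 + 1)) (compDefectAt R.rc Lc (n + 1 + 1)
        (coProjBmW (toSite (R.s (n + 1 + 1))) (Lc ^ (n + 1 + 1)) (Hcol (N := Lc ^ (n + 1 + 1)) a 0))))) κ) t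
    simp only [contourSum] at hg hζ ⊢
    simp only [hcol, hK, Finset.sum_add_distrib, Finset.sum_sub_distrib, ← Finset.mul_sum, hg, hζ]
    simp only [dz]
    ring

/-- [folklore] **`dressingInvisible` — (DIᶜ) ON `ℤ⁴`: bounded co-closed covectors cannot tell the composite chart's column from the straight one after ANY straight contour sum**
(`Mc ≥ 1`; every root family `R`, every storey `n`, every source direction `a`). -/
theorem dressingInvisible (R : Roots Lc) (n : ℕ) {Mc : ℕ} (hMc : 1 ≤ Mc) (a : Fin (3 + 1)) (ψ : Form1 (3 + 1) ℝ) (M : ℝ)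
    (hψ : ∀ c x, |ψ c x| ≤ M) (hco : codiff₁ ψ = 0) :
    lip1 ψ (contourSum Mc (fun κ' u => colH (AN R (n + 1)) (Lc ^ (n + 1 + 1)) a 0 κ' u))
      = lip1 ψ (contourSum Mc (fun κ' u => colH (KInv (N := Lc ^ (n + 1 + 1))) (Lc ^ (n + 1 + 1)) a 0 κ' u)) := by
  obtain ⟨G, hG, hEq⟩ := contourSum_colH_AN_eq_add_dz Lc R n hMc a
  have hX : ∀ κ, Summable (contourSum Mc (fun κ' u => colH (KInv (N := Lc ^ (n + 1 + 1))) (Lc ^ (n + 1 + 1)) a 0 κ' u) κ) :=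
    summable_contourSum' hMc (fun κ' => summable_colH_KInv_zero (Lc ^ (n + 1 + 1)) a κ')
  have h : contourSum Mc (fun κ' u => colH (AN R (n + 1)) (Lc ^ (n + 1 + 1)) a 0 κ' u)
      = fun κ t => contourSum Mc (fun κ' u => colH (KInv (N := Lc ^ (n + 1 + 1))) (Lc ^ (n + 1 + 1)) a 0 κ' u) κ t + dz G κ t := by
    funext κ t; exact hEq κ t
  rw [h]
  exact lip1_add_dz_eq hψ hco hX hG

/-- [folklore] **`dressingInvisible_ctr` — PART 101a's displayed letter `hinv` (DIᶜ)_n, VERBATIM** (roots `Roots.ctr Lc`, contour scale `Lc^(n+1)`). -/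
theorem dressingInvisible_ctr (n : ℕ) (a : Fin (3 + 1)) (ψ : Form1 (3 + 1) ℝ) (M : ℝ) (hψ : ∀ c x, |ψ c x| ≤ M) (hco : codiff₁ ψ = 0) :
    lip1 ψ (contourSum (Lc ^ (n + 1)) (fun κ' u => colH (AN (Roots.ctr Lc) (n + 1)) (Lc ^ (n + 1 + 1)) a 0 κ' u))
      = lip1 ψ (contourSum (Lc ^ (n + 1)) (fun κ' u => colH (KInv (N := Lc ^ (n + 1 + 1))) (Lc ^ (n + 1 + 1)) a 0 κ' u)) :=
  dressingInvisible Lc (Roots.ctr Lc) n (one_le_of_neZero (Lc ^ (n + 1))) a ψ M hψ hco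

end Column

/-! ## §3 (K1ᶜ)_n BY NAME, and the road's `hgaugeD n` from `sn n ≠ 0` alone (PART 101a ∘ §2) -/

section K1c

variable (Lc : ℕ) [NeZero Lc] (Q : StepRows 3 Lc) (sn α : ℕ → ℝ)

/-- [folklore] **`columnLetter` — (K1ᶜ)_n, PART 100's `hK1c` TEXT, PROVED at `α n = (sn n · (Lc⁴)^(n+1))⁻¹`** (PART 101a `columnLetter_of_dressingInvisible` fed §2 `dressingInvisible_ctr`). -/
theorem columnLetter (n : ℕ) (hαv : α n = (sn n * ((Lc : ℝ) ^ (3 + 1)) ^ (n + 1))⁻¹)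
    (a : Fin (3 + 1)) (ψ : Form1 (3 + 1) ℝ) (M : ℝ) (hψ : ∀ c x, |ψ c x| ≤ M) (hco : codiff₁ ψ = 0) :
    lip1 ψ (contourSum (Lc ^ (n + 1)) (fun κ' u => colH (chartσ Lc (sn n) n) (Lc ^ (n + 1 + 1)) a 0 κ' u))
      = (α n * (((((Lc : ℝ) ^ (3 + 1))⁻¹) ^ (n + 1))⁻¹)) * lip1 ψ (fun c x => wStep Lc (n + 1) c a (-x)) :=
  columnLetter_of_dressingInvisible Lc sn α n hαv (fun a' ψ' M' hψ' hco' => dressingInvisible_ctr Lc n a' ψ' M' hψ' hco') a ψ M hψ hco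

/-- [folklore] **`lip1_contourSum_colH_chartσ_eq` — THE SAME WITHOUT A NAMED SCALAR: `⟨ψ, contourSum (Lc^(n+1)) (colH (chartσ …) (Lc^(n+2)) a 0)⟩ = (sn n)⁻¹ · ⟨ψ, wStep Lc (n+1) · a (−·)⟩`**
for every bounded co-closed `ψ` — the K1.md §6 ∕ A2-HQF0 (G) column identity of the record's σ-chart, on `ℤ⁴`, at every storey. -/
theorem lip1_contourSum_colH_chartσ_eq (n : ℕ) (a : Fin (3 + 1)) (ψ : Form1 (3 + 1) ℝ) (M : ℝ) (hψ : ∀ c x, |ψ c x| ≤ M) (hco : codiff₁ ψ = 0) :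
    lip1 ψ (contourSum (Lc ^ (n + 1)) (fun κ' u => colH (chartσ Lc (sn n) n) (Lc ^ (n + 1 + 1)) a 0 κ' u))
      = (sn n)⁻¹ * lip1 ψ (fun c x => wStep Lc (n + 1) c a (-x)) := by
  have hL : (Lc : ℝ) ≠ 0 := by exact_mod_cast (NeZero.ne Lc)
  rw [columnLetter Lc sn (fun m => (sn m * ((Lc : ℝ) ^ (3 + 1)) ^ (m + 1))⁻¹) n rfl a ψ M hψ hco]
  congr 1
  rw [inv_pow, inv_inv, mul_inv, mul_assoc, inv_mul_cancel₀ (pow_ne_zero _ (pow_ne_zero _ hL)), mul_one]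

/-- [folklore] **`hgaugeD_rooted` — THE ROAD's DUAL GAUGE LETTER `hgaugeD n` AT THE ROOTED ROWS, FROM `sn n ≠ 0` AND THE VALUE OF `α n` ALONE**:
`lip1 ψ (fun c x => (α n)⁻¹ * wF … (linKerAt (toSite (ctrOff 4 Lc)) Lc) sn n c a (−x) − wStep Lc (n+1) c a (−x)) = 0` for bounded co-closed `ψ`. -/
theorem hgaugeD_rooted (n : ℕ) (hsn : sn n ≠ 0) (hαv : α n = (sn n * ((Lc : ℝ) ^ (3 + 1)) ^ (n + 1))⁻¹)
    (a : Fin (3 + 1)) (ψ : Form1 (3 + 1) ℝ) (M : ℝ) (hψ : ∀ c x, |ψ c x| ≤ M) (hco : codiff₁ ψ = 0) :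
    lip1 ψ (fun c x => (α n)⁻¹ * wF Lc Q (linKerAt (toSite (ctrOff (3 + 1) Lc)) Lc) sn n c a (-x) - wStep Lc (n + 1) c a (-x)) = 0 :=
  hgaugeD_rooted_of_dressingInvisible Lc Q sn α n hsn hαv (fun a' ψ' M' hψ' hco' => dressingInvisible_ctr Lc n a' ψ' M' hψ' hco') a ψ M hψ hco

/-- [folklore] **`hgaugeD_sym` — THE SAME AT THE (0.4)-SYMMETRISED ROWS** (`symLinKerAt (toSite R.r) Lc`, any `R : Roots Lc`). -/
theorem hgaugeD_sym (R : Roots Lc) (n : ℕ) (hsn : sn n ≠ 0) (hαv : α n = (sn n * ((Lc : ℝ) ^ (3 + 1)) ^ (n + 1))⁻¹)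
    (a : Fin (3 + 1)) (ψ : Form1 (3 + 1) ℝ) (M : ℝ) (hψ : ∀ c x, |ψ c x| ≤ M) (hco : codiff₁ ψ = 0) :
    lip1 ψ (fun c x => (α n)⁻¹ * wF Lc Q (symLinKerAt (toSite R.r) Lc) sn n c a (-x) - wStep Lc (n + 1) c a (-x)) = 0 :=
  hgaugeD_sym_of_dressingInvisible Lc Q sn α R n hsn hαv (fun a' ψ' M' hψ' hco' => dressingInvisible_ctr Lc n a' ψ' M' hψ' hco') a ψ M hψ hco

end K1c

end Summit.QuantumFields.BalabanUV.Beta.FP.TowerFWeightDressingInvisible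

end
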